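/-
Copyright: statement-level skeleton of a published paper (lit-balaban cell, Phase-2 proof seat p39 gen 10). No proof claims
beyond what the kernel checks below.
-/
import Literature.MathematicalPhysics.QuantumFieldTheory.Balaban1983to89.B3Eq338KernelForm

/-!
# B3 — T. Bałaban, *(Higgs)₂,₃ quantum fields in a finite volume. III. Renormalization*, CMP **88** (1983) 411–445
[Balaban1983Higgs3], p. 444 [PDF 34], the replacement sentence for the triangle factor of the graphs **(2.20)** — *"Now we replace
the propagators G^η_{j₀}(0), G^η_{j₀} by C^ξ in the way described several times. We get a convergent expression plus
Σ_{y,y″}ξ^{2d}Γ″_μ(y,y′,y″) defined with the help of the propagator C^ξ"* — PART 1 OF THE ESTIMATES: the inner line sum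
`L(x) = Σ_{y″}ξ³(∂^ξ_μK₂∂^{ξ*}_ν)(x,y″)K₃(y′,y″)` of the summation-by-parts form (`B3Eq338KernelForm`) is bounded, uniformly in the
spacing, as soon as ONE of its two lines carries the difference kernel `M = G^ξ_k(0) − C^ξ` of p. 437, and has the law of a
propagator when both lines are propagators

statement-level skeleton of published theorems with citation tags; proofs where landed; nothing here is a claim about
the Yang–Mills mass gap

PDF held: `paper:balaban1983-higgs-2-3-quantum-fields-finite-volume` (journal page = PDF page + 410); p. 444 [PDF 34] read on the
×2 render `run/shared/lean/pub/pub-balaban/b2b-balaban-ref1/pages/1983-cmp88-higgs23-III/1983-cmp88-higgs23-III-p034-x2.png`.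
Row **B3.Eq3.33-3.38** of `HOME/lit-balaban-r15/ROWS-B3.md` (fold owner r15).  CONTEXT: see `B3Eq338KernelForm` (the three-slot
factor `tri20` and its summation-by-parts form) and `B3Eq338ZeroLattice` (the assembly at the zero-field instance).  The kernel
laws are those of p. 437 (*"|C^ξ(y−y′)| ≦ O(1)e^{−½|y−y′|}/|y−y′|, |G^ξ_{j″}(0;y,y′)| ≦ O(1)e^{−δ₀|y−y′|}/|y−y′|, and the corresponding
inequalities for derivatives"*) in the profile language `P_q^δ(u) = (ξ·max(1,|u|_∞))^{−q}e^{−δξ|u|_∞}` (`prof`) of gen 9's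
`B3Eq316DifferenceKernelBounds`, whose composition lemmas on ℤ³ (`B3ZdKernelConvolutions.conv22_le₂`, `tsum_profile_one_mul_le`,
`tsum_profile_le`) do all the work.
WHAT IS PROVED (MODEL-FREE unless said; `0 < ξ ≤ 1`, `0 < δ ≤ 1`, two-variable kernels on ξℤ³):
* §1 the profile toolkit in `prof` notation (`prof_summable_left/right`, `prof_pair_le`, `prof_conv22_le`, `summable_of_le_prof_left/
  right`) and **`sbp_hypotheses_of_laws`** — the five summability hypotheses of `B3Eq338KernelForm.tri20_eq_sbpForm` hold for any
  kernels with once/twice-differentiated laws on `K₁`, `K₂` and a bounded `K₃` (exponential decay at fixed `ξ`).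
* §2 **`abs_Lker_le_profile_of_laws`** (BOTH LINES PROPAGATORS): if `|(∂_μK₂)(x,w)| ≤ A₂P₂(x−w)` and `|(K₃∂^*_ν)(y′,w)| ≤ A₃P₂(y′−w)`
  then `|L(x)| ≤ 4e·1400·A₂A₃·P₁^{δ/2}(x−y′)` — after the `y″`-summation by parts (`Lker_eq_sbp`) the two once-differentiated lines
  compose like two propagator derivatives (`conv22_le₂`).
* §3 **`abs_Lker_le_const_of_laws`** (THE MIDDLE LINE CARRIES `M`): if `|(∂_μK₂∂^*_ν)(x,w)| ≤ A₂P₁^{δ}(x−w)` (the law of the mixed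
  difference of `M`, gen 9's `abs_d2K_MxiL_le`) and `|K₃(y′,w)| ≤ A₃P₁(y′−w)` then `|L(x)| ≤ A₂A₃·833/δ³` for ALL `x` (AM–GM pair sum).
* §4 **`abs_Lker_conv_M_le_const`** (THE LAST LINE CARRIES `M`, at the instance `ξ = L^{−k}`): for `K₂ = C^ξ` and `K₃ = M = G(1−m²−aP)C^ξ`
  (`B3Eq316ResolventZeroLattice.hasSum_resolvent316`), `|L(x)| ≤ 1400·A·C²·833/(δ/2)³` for all `x` (`A` the law of `∂C^ξ`): after the `y″`-summation by parts the
  difference falls on the `C^ξ` inside `M`, the `y″`-sum is done first inside the convolution (`conv22_le₂`), then the middle-factor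
  sum (Tonelli, gen 9's `tsum_tsum_le_of_nonneg`) — the mechanism of gen 9's `fubini_bound_of_laws` with two centres.
HONEST SCOPE: estimates of the inner line sum only; the outer `y`-sum, the split `G = C^ξ + M` and the statement of the replacement
sentence for (2.20) are in `B3Eq338ZeroLattice`.  Mathlib + the cited tree files only; theorems only, no definitions, no named
facts; standard axioms.  Unit `lit-balaban-p39-g10` (Phase-2 proof seat p39, gen 10), HOME `run/shared/lean/pub/lit-balaban/`, 2026-08-22.
-/

open scoped BigOperators
open Finset Filter Topology

namespace Literature.MathematicalPhysics.QuantumFieldTheory.Balaban1983to89.B3Eq338LkerBounds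

open B3Sect3VectorSelfEnergy B3CxiUniformBound B3ZdLatticeProfileSums B3ZdKernelConvolutions B3Eq316ResolventZeroLattice
  B3Eq316DifferenceKernelBounds B3Eq338KernelForm
open B3CxiLatticePairSums (supNorm_unitVec)

noncomputable section

/-! ## §1 The profile toolkit in `prof` notation; the summability hypotheses of the summation-by-parts form -/

section Toolkit

variable {ξ δ : ℝ}

/-- kernel: `z ↦ ξ³P_q^δ(x − z)` is summable with sum `≤ 833/δ³` (`q ≤ 2`). [cite: Balaban1983Higgs3, (3.16) p.437] -/
theorem prof_summable_left (hξ : 0 < ξ) (hξ1 : ξ ≤ 1) (hδ : 0 < δ) (hδ1 : δ ≤ 1) {q : ℕ} (hq : q ≤ 2) (x : ZSite 3) :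
    Summable (fun z : ZSite 3 => ξ ^ 3 * prof ξ δ q (x - z)) ∧ ∑' z : ZSite 3, ξ ^ 3 * prof ξ δ q (x - z) ≤ 833 / δ ^ 3 :=
  (tsum_profile_shift_le hξ hξ1 hδ hδ1 hq x x).1

/-- kernel: `z ↦ ξ³P_q^δ(z − y)` is summable with sum `≤ 833/δ³` (`q ≤ 2`). [cite: Balaban1983Higgs3, (3.16) p.437] -/
theorem prof_summable_right (hξ : 0 < ξ) (hξ1 : ξ ≤ 1) (hδ : 0 < δ) (hδ1 : δ ≤ 1) {q : ℕ} (hq : q ≤ 2) (y : ZSite 3) :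
    Summable (fun z : ZSite 3 => ξ ^ 3 * prof ξ δ q (z - y)) ∧ ∑' z : ZSite 3, ξ ^ 3 * prof ξ δ q (z - y) ≤ 833 / δ ^ 3 :=
  (tsum_profile_shift_le hξ hξ1 hδ hδ1 hq y y).2

/-- kernel: the AM–GM pair sum `Σ'_zξ³P₁(x−z)P₁(z−y) ≤ 833/δ³`. [cite: Balaban1983Higgs3, (3.16) p.437] -/
theorem prof_pair_le (hξ : 0 < ξ) (hξ1 : ξ ≤ 1) (hδ : 0 < δ) (hδ1 : δ ≤ 1) (x y : ZSite 3) :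
    Summable (fun z : ZSite 3 => ξ ^ 3 * (prof ξ δ 1 (x - z) * prof ξ δ 1 (z - y))) ∧
      ∑' z : ZSite 3, ξ ^ 3 * (prof ξ δ 1 (x - z) * prof ξ δ 1 (z - y)) ≤ 833 / δ ^ 3 :=
  tsum_profile_one_mul_le hξ hξ1 hδ hδ1 x y

/-- kernel: the sharp composition `Σ'_zξ³P₂(x−z)P₂(z−y) ≤ 1400·P₁^{δ/2}(x−y)` in `prof` notation. [cite: Balaban1983Higgs3, (3.16) p.437] -/
theorem prof_conv22_le (hξ : 0 < ξ) (hδ : 0 < δ) (x y : ZSite 3) :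
    Summable (fun z : ZSite 3 => ξ ^ 3 * (prof ξ δ 2 (x - z) * prof ξ δ 2 (z - y))) ∧
      ∑' z : ZSite 3, ξ ^ 3 * (prof ξ δ 2 (x - z) * prof ξ δ 2 (z - y)) ≤ 1400 * prof ξ (δ / 2) 1 (x - y) := by
  obtain ⟨hs, hle⟩ := conv22_le₂ hξ hδ x y
  refine ⟨hs, hle.trans_eq ?_⟩
  rw [prof, pow_one]

/-- kernel: a function dominated by a translated profile (`q ≤ 2`) is summable. [cite: Balaban1983Higgs3, (3.16) p.437] -/
theorem summable_of_le_prof_left (hξ : 0 < ξ) (hξ1 : ξ ≤ 1) (hδ : 0 < δ) (hδ1 : δ ≤ 1) {q : ℕ} (hq : q ≤ 2) (x : ZSite 3)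
    {f : ZSite 3 → ℝ} {c : ℝ} (h : ∀ z, |f z| ≤ c * (ξ ^ 3 * prof ξ δ q (x - z))) : Summable f :=
  (Summable.of_nonneg_of_le (fun _ => abs_nonneg _) h ((prof_summable_left hξ hξ1 hδ hδ1 hq x).1.mul_left c)).of_abs

/-- kernel: a function dominated by a translated profile (`q ≤ 2`, other orientation) is summable. [cite: Balaban1983Higgs3, (3.16) p.437] -/
theorem summable_of_le_prof_right (hξ : 0 < ξ) (hξ1 : ξ ≤ 1) (hδ : 0 < δ) (hδ1 : δ ≤ 1) {q : ℕ} (hq : q ≤ 2) (y : ZSite 3)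
    {f : ZSite 3 → ℝ} {c : ℝ} (h : ∀ z, |f z| ≤ c * (ξ ^ 3 * prof ξ δ q (z - y))) : Summable f :=
  (Summable.of_nonneg_of_le (fun _ => abs_nonneg _) h ((prof_summable_right hξ hξ1 hδ hδ1 hq y).1.mul_left c)).of_abs

/-- **The line sum `L(x)` of bounded kernels is bounded** (at fixed `ξ`): if `|(∂_μK₂∂^*_ν)(x,w)| ≤ A₂P₂(x−w)` and `|K₃(y′,w)| ≤ B` then
the `L`-series converges and `|L(x)| ≤ A₂B·833/δ³`. [cite: Balaban1983Higgs3, (3.38) p.444] -/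
theorem abs_Lker_le_crude (hξ : 0 < ξ) (hξ1 : ξ ≤ 1) (hδ : 0 < δ) (hδ1 : δ ≤ 1) {μ ν : Fin 3}
    {K₂ K₃ : ZSite 3 → ZSite 3 → ℝ} {y' : ZSite 3} {A₂ B : ℝ} (hA : 0 ≤ A₂) (hB : 0 ≤ B)
    (h2 : ∀ x w, |d2K ξ μ ν K₂ x w| ≤ A₂ * prof ξ δ 2 (x - w)) (h3 : ∀ w, |K₃ y' w| ≤ B) (x : ZSite 3) :
    Summable (fun w => ξ ^ 3 * (d2K ξ μ ν K₂ x w * K₃ y' w)) ∧ |Lker ξ μ ν K₂ K₃ y' x| ≤ A₂ * B * (833 / δ ^ 3) := by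
  have hdom : ∀ w, |ξ ^ 3 * (d2K ξ μ ν K₂ x w * K₃ y' w)| ≤ A₂ * B * (ξ ^ 3 * prof ξ δ 2 (x - w)) := by
    intro w
    rw [abs_mul, abs_of_pos (pow_pos hξ 3), abs_mul]
    have hp := prof_nonneg hξ.le δ 2 (x - w)
    calc ξ ^ 3 * (|d2K ξ μ ν K₂ x w| * |K₃ y' w|) ≤ ξ ^ 3 * (A₂ * prof ξ δ 2 (x - w) * B) :=
          mul_le_mul_of_nonneg_left (mul_le_mul (h2 x w) (h3 w) (abs_nonneg _) (by positivity)) (pow_pos hξ 3).le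
      _ = A₂ * B * (ξ ^ 3 * prof ξ δ 2 (x - w)) := by ring
  obtain ⟨hsP, hbP⟩ := prof_summable_left hξ hξ1 hδ hδ1 (le_refl 2) x
  have hs : Summable (fun w => ξ ^ 3 * (d2K ξ μ ν K₂ x w * K₃ y' w)) :=
    summable_of_le_prof_left hξ hξ1 hδ hδ1 (le_refl 2) x hdom
  refine ⟨hs, ?_⟩
  unfold Lker
  refine (abs_tsum_le_tsum_of_abs_le hs (hsP.mul_left _) hdom).trans ?_
  rw [tsum_mul_left]
  exact mul_le_mul_of_nonneg_left hbP (by positivity)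

/-- **The line sum `N(x)` of bounded kernels is bounded** (at fixed `ξ`): if `|(K₂∂^*_ν)(x,w)| ≤ A₂P₂(x−w)` and `|K₃(y′,w)| ≤ B` then the
`N`-series converges and `|N(x)| ≤ A₂B·833/δ³`. [cite: Balaban1983Higgs3, (3.38) p.444] -/
theorem abs_Nker_le_crude (hξ : 0 < ξ) (hξ1 : ξ ≤ 1) (hδ : 0 < δ) (hδ1 : δ ≤ 1) {ν : Fin 3}
    {K₂ K₃ : ZSite 3 → ZSite 3 → ℝ} {y' : ZSite 3} {A₂ B : ℝ} (hA : 0 ≤ A₂) (hB : 0 ≤ B)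
    (h2 : ∀ x w, |dK2 ξ ν K₂ x w| ≤ A₂ * prof ξ δ 2 (x - w)) (h3 : ∀ w, |K₃ y' w| ≤ B) (x : ZSite 3) :
    Summable (fun w => ξ ^ 3 * (dK2 ξ ν K₂ x w * K₃ y' w)) ∧ |Nker ξ ν K₂ K₃ y' x| ≤ A₂ * B * (833 / δ ^ 3) := by
  have hdom : ∀ w, |ξ ^ 3 * (dK2 ξ ν K₂ x w * K₃ y' w)| ≤ A₂ * B * (ξ ^ 3 * prof ξ δ 2 (x - w)) := by
    intro w
    rw [abs_mul, abs_of_pos (pow_pos hξ 3), abs_mul]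
    have hp := prof_nonneg hξ.le δ 2 (x - w)
    calc ξ ^ 3 * (|dK2 ξ ν K₂ x w| * |K₃ y' w|) ≤ ξ ^ 3 * (A₂ * prof ξ δ 2 (x - w) * B) :=
          mul_le_mul_of_nonneg_left (mul_le_mul (h2 x w) (h3 w) (abs_nonneg _) (by positivity)) (pow_pos hξ 3).le
      _ = A₂ * B * (ξ ^ 3 * prof ξ δ 2 (x - w)) := by ring
  obtain ⟨hsP, hbP⟩ := prof_summable_left hξ hξ1 hδ hδ1 (le_refl 2) x
  have hs : Summable (fun w => ξ ^ 3 * (dK2 ξ ν K₂ x w * K₃ y' w)) :=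
    summable_of_le_prof_left hξ hξ1 hδ hδ1 (le_refl 2) x hdom
  refine ⟨hs, ?_⟩
  unfold Nker
  refine (abs_tsum_le_tsum_of_abs_le hs (hsP.mul_left _) hdom).trans ?_
  rw [tsum_mul_left]
  exact mul_le_mul_of_nonneg_left hbP (by positivity)

/-- **THE SUMMABILITY HYPOTHESES OF THE SUMMATION-BY-PARTS FORM** (`B3Eq338KernelForm.tri20_eq_sbpForm`) hold for kernels with a
once-differentiated law on the first line (`|(∂_νK₁)(y′,y)| ≤ A₁P₂(y′−y)`), once/twice-differentiated laws on the middle line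
(`|(∂_μK₂∂^*_ν)(x,w)|, |(K₂∂^*_ν)(x,w)| ≤ A₂P₂(x−w)`) and a bounded last line (`|K₃(y′,w)| ≤ B`) — at fixed `ξ` every such series
converges absolutely. [cite: Balaban1983Higgs3, (3.38) p.444] -/
theorem sbp_hypotheses_of_laws (hξ : 0 < ξ) (hξ1 : ξ ≤ 1) (hδ : 0 < δ) (hδ1 : δ ≤ 1) {μ : Fin 3}
    {K₁ K₂ K₃ : ZSite 3 → ZSite 3 → ℝ} {y' : ZSite 3} {A₁ A₂ B : ℝ} (hA1 : 0 ≤ A₁) (hA2 : 0 ≤ A₂) (hB : 0 ≤ B)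
    (h1 : ∀ (ν : Fin 3) (y : ZSite 3), |dK1 ξ ν K₁ y' y| ≤ A₁ * prof ξ δ 2 (y' - y))
    (h2 : ∀ (ν : Fin 3) (x w : ZSite 3), |d2K ξ μ ν K₂ x w| ≤ A₂ * prof ξ δ 2 (x - w))
    (h2' : ∀ (ν : Fin 3) (x w : ZSite 3), |dK2 ξ ν K₂ x w| ≤ A₂ * prof ξ δ 2 (x - w))
    (h3 : ∀ w, |K₃ y' w| ≤ B) :
    (∀ (ν : Fin 3) (x : ZSite 3), Summable fun w => ξ ^ 3 * (d2K ξ μ ν K₂ x w * K₃ y' w)) ∧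
    (∀ (ν : Fin 3) (x : ZSite 3), Summable fun w => ξ ^ 3 * (dK2 ξ ν K₂ x w * K₃ y' w)) ∧
    (∀ ν : Fin 3, Summable fun y => ξ ^ 3 * (dK1 ξ ν K₁ y' y * Lker ξ μ ν K₂ K₃ y' y)) ∧
    (∀ ν : Fin 3, Summable fun y => dK1 ξ ν K₁ y' (y + unitVec μ) * Nker ξ ν K₂ K₃ y' y) ∧
    (∀ ν : Fin 3, Summable fun y => dK1 ξ ν K₁ y' y * Nker ξ ν K₂ K₃ y' y) := by
  have hL := fun (ν : Fin 3) (x : ZSite 3) => abs_Lker_le_crude hξ hξ1 hδ hδ1 hA2 hB (h2 ν) h3 x (μ := μ) (ν := ν)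
  have hN := fun (ν : Fin 3) (x : ZSite 3) => abs_Nker_le_crude hξ hξ1 hδ hδ1 hA2 hB (h2' ν) h3 x (ν := ν)
  set BL : ℝ := A₂ * B * (833 / δ ^ 3) with hBL
  have hBL0 : 0 ≤ BL := by positivity
  refine ⟨fun ν x => (hL ν x).1, fun ν x => (hN ν x).1, fun ν => ?_, fun ν => ?_, fun ν => ?_⟩
  · -- `y ↦ ξ³(∂_νK₁)(y′,y)L(y)`: profile-dominated in `y`
    refine summable_of_le_prof_left hξ hξ1 hδ hδ1 (le_refl 2) y' (c := A₁ * BL) fun y => ?_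
    rw [abs_mul, abs_of_pos (pow_pos hξ 3), abs_mul]
    have hp := prof_nonneg hξ.le δ 2 (y' - y)
    calc ξ ^ 3 * (|dK1 ξ ν K₁ y' y| * |Lker ξ μ ν K₂ K₃ y' y|) ≤ ξ ^ 3 * (A₁ * prof ξ δ 2 (y' - y) * BL) :=
          mul_le_mul_of_nonneg_left (mul_le_mul (h1 ν y) (hL ν y).2 (abs_nonneg _) (by positivity)) (pow_pos hξ 3).le
      _ = A₁ * BL * (ξ ^ 3 * prof ξ δ 2 (y' - y)) := by ring
  · -- the shifted product: dominated by the profile centred at `y′ − e_μ`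
    refine summable_of_le_prof_left hξ hξ1 hδ hδ1 (le_refl 2) (y' - unitVec μ) (c := A₁ * BL * (ξ ^ 3)⁻¹) fun y => ?_
    rw [abs_mul]
    have hp := prof_nonneg hξ.le δ 2 (y' - unitVec μ - y)
    have e : y' - (y + unitVec μ) = y' - unitVec μ - y := by abel
    have hk := h1 ν (y + unitVec μ)
    rw [e] at hk
    calc |dK1 ξ ν K₁ y' (y + unitVec μ)| * |Nker ξ ν K₂ K₃ y' y| ≤ A₁ * prof ξ δ 2 (y' - unitVec μ - y) * BL :=
          mul_le_mul hk (hN ν y).2 (abs_nonneg _) (by positivity)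
      _ = A₁ * BL * (ξ ^ 3)⁻¹ * (ξ ^ 3 * prof ξ δ 2 (y' - unitVec μ - y)) := by
          field_simp
  · refine summable_of_le_prof_left hξ hξ1 hδ hδ1 (le_refl 2) y' (c := A₁ * BL * (ξ ^ 3)⁻¹) fun y => ?_
    rw [abs_mul]
    have hp := prof_nonneg hξ.le δ 2 (y' - y)
    calc |dK1 ξ ν K₁ y' y| * |Nker ξ ν K₂ K₃ y' y| ≤ A₁ * prof ξ δ 2 (y' - y) * BL :=
          mul_le_mul (h1 ν y) (hN ν y).2 (abs_nonneg _) (by positivity)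
      _ = A₁ * BL * (ξ ^ 3)⁻¹ * (ξ ^ 3 * prof ξ δ 2 (y' - y)) := by
          field_simp

end Toolkit

/-! ## §2 Both lines propagators: `L` has the law of a propagator (after the `y″`-summation by parts) -/

section Profile

variable {ξ δ : ℝ}

/-- **`|L(x)| ≤ 4e·1400·A₂A₃·P₁^{δ/2}(x − y′)` WHEN BOTH LINES ARE PROPAGATORS**: if `|(∂_μK₂)(x,w)| ≤ A₂P₂^δ(x−w)` (all `x, w`),
`|(K₃∂^*_ν)(y′,w)| ≤ A₃P₂^δ(y′−w)` (all `w`) and `K₃(y′,·)` is bounded, then the `y″`-summation by parts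
(`B3Eq338KernelForm.Lker_eq_sbp`) puts ONE difference on each line, a unit shift costs `4e` (`prof_shift_le`), and the two
once-differentiated lines compose to a propagator law (`conv22_le₂`). [cite: Balaban1983Higgs3, (3.38) p.444] -/
theorem abs_Lker_le_profile_of_laws (hξ : 0 < ξ) (hξ1 : ξ ≤ 1) (hδ : 0 < δ) (hδ1 : δ ≤ 1) {μ ν : Fin 3}
    {K₂ K₃ : ZSite 3 → ZSite 3 → ℝ} {y' : ZSite 3} {A₂ A₃ B : ℝ} (hA2 : 0 ≤ A₂) (hA3 : 0 ≤ A₃)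
    (h2 : ∀ x w, |dK1 ξ μ K₂ x w| ≤ A₂ * prof ξ δ 2 (x - w))
    (h3 : ∀ w, |dK2 ξ ν K₃ y' w| ≤ A₃ * prof ξ δ 2 (y' - w)) (h3b : ∀ w, |K₃ y' w| ≤ B) (x : ZSite 3) :
    |Lker ξ μ ν K₂ K₃ y' x| ≤ 4 * Real.exp 1 * 1400 * A₂ * A₃ * prof ξ (δ / 2) 1 (x - y') := by
  -- the two summability hypotheses of `Lker_eq_sbp`
  have hs1 : Summable fun w => dK1 ξ μ K₂ x (w + unitVec ν) * K₃ y' w := by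
    refine summable_of_le_prof_left hξ hξ1 hδ hδ1 (le_refl 2) (x - unitVec ν) (c := A₂ * B * (ξ ^ 3)⁻¹) fun w => ?_
    have e : x - (w + unitVec ν) = x - unitVec ν - w := by abel
    have hk := h2 x (w + unitVec ν); rw [e] at hk
    have hp := prof_nonneg hξ.le δ 2 (x - unitVec ν - w)
    rw [abs_mul]
    calc |dK1 ξ μ K₂ x (w + unitVec ν)| * |K₃ y' w| ≤ A₂ * prof ξ δ 2 (x - unitVec ν - w) * B :=
          mul_le_mul hk (h3b w) (abs_nonneg _) (by positivity)
      _ = A₂ * B * (ξ ^ 3)⁻¹ * (ξ ^ 3 * prof ξ δ 2 (x - unitVec ν - w)) := by field_simp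
  have hs2 : Summable fun w => dK1 ξ μ K₂ x w * K₃ y' w := by
    refine summable_of_le_prof_left hξ hξ1 hδ hδ1 (le_refl 2) x (c := A₂ * B * (ξ ^ 3)⁻¹) fun w => ?_
    have hp := prof_nonneg hξ.le δ 2 (x - w)
    rw [abs_mul]
    calc |dK1 ξ μ K₂ x w| * |K₃ y' w| ≤ A₂ * prof ξ δ 2 (x - w) * B :=
          mul_le_mul (h2 x w) (h3b w) (abs_nonneg _) (by positivity)
      _ = A₂ * B * (ξ ^ 3)⁻¹ * (ξ ^ 3 * prof ξ δ 2 (x - w)) := by field_simp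
  rw [Lker_eq_sbp x hs1 hs2]
  -- the backward difference of the last line is a shifted `K₃∂^*`: `ξ⁻¹(K₃(y′,w−e) − K₃(y′,w)) = −(K₃∂^*_ν)(y′,w−e)`
  have hbd : ∀ w, |pdiffAdjZ ξ⁻¹ ν (K₃ y') w| ≤ 4 * Real.exp 1 * A₃ * prof ξ δ 2 (w - y') := by
    intro w
    have e1 : pdiffAdjZ ξ⁻¹ ν (K₃ y') w = -dK2 ξ ν K₃ y' (w - unitVec ν) := by
      unfold pdiffAdjZ dK2; rw [sub_add_cancel]; ring
    rw [e1, abs_neg]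
    refine (h3 (w - unitVec ν)).trans ?_
    have e2 : y' - (w - unitVec ν) = y' - w + unitVec ν := by abel
    rw [e2]
    have hsh := prof_shift_le hξ hξ1 hδ.le hδ1 2 (y' - w) (unitVec ν) (supNorm_unitVec ν).1.le
    rw [prof_sub_comm ξ δ 2 w y']
    calc A₃ * prof ξ δ 2 (y' - w + unitVec ν) ≤ A₃ * (2 ^ 2 * Real.exp 1 * prof ξ δ 2 (y' - w)) :=
          mul_le_mul_of_nonneg_left hsh hA3
      _ = 4 * Real.exp 1 * A₃ * prof ξ δ 2 (y' - w) := by norm_num; ring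
  obtain ⟨hsC, hbC⟩ := prof_conv22_le hξ hδ x y'
  have hdom : ∀ w, |ξ ^ 3 * (dK1 ξ μ K₂ x w * pdiffAdjZ ξ⁻¹ ν (K₃ y') w)| ≤
      4 * Real.exp 1 * A₂ * A₃ * (ξ ^ 3 * (prof ξ δ 2 (x - w) * prof ξ δ 2 (w - y'))) := by
    intro w
    rw [abs_mul, abs_of_pos (pow_pos hξ 3), abs_mul]
    have hp1 := prof_nonneg hξ.le δ 2 (x - w)
    have hp2 := prof_nonneg hξ.le δ 2 (w - y')
    calc ξ ^ 3 * (|dK1 ξ μ K₂ x w| * |pdiffAdjZ ξ⁻¹ ν (K₃ y') w|)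
        ≤ ξ ^ 3 * (A₂ * prof ξ δ 2 (x - w) * (4 * Real.exp 1 * A₃ * prof ξ δ 2 (w - y'))) :=
          mul_le_mul_of_nonneg_left (mul_le_mul (h2 x w) (hbd w) (abs_nonneg _) (by positivity)) (pow_pos hξ 3).le
      _ = 4 * Real.exp 1 * A₂ * A₃ * (ξ ^ 3 * (prof ξ δ 2 (x - w) * prof ξ δ 2 (w - y'))) := by ring
  have hs : Summable fun w => ξ ^ 3 * (dK1 ξ μ K₂ x w * pdiffAdjZ ξ⁻¹ ν (K₃ y') w) :=
    (Summable.of_nonneg_of_le (fun _ => abs_nonneg _) hdom (hsC.mul_left _)).of_abs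
  refine (abs_tsum_le_tsum_of_abs_le hs (hsC.mul_left _) hdom).trans ?_
  rw [tsum_mul_left]
  have h0 : 0 ≤ 4 * Real.exp 1 * A₂ * A₃ := by positivity
  calc 4 * Real.exp 1 * A₂ * A₃ * ∑' w, ξ ^ 3 * (prof ξ δ 2 (x - w) * prof ξ δ 2 (w - y'))
      ≤ 4 * Real.exp 1 * A₂ * A₃ * (1400 * prof ξ (δ / 2) 1 (x - y')) := mul_le_mul_of_nonneg_left hbC h0
    _ = 4 * Real.exp 1 * 1400 * A₂ * A₃ * prof ξ (δ / 2) 1 (x - y') := by ring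

end Profile

/-! ## §3 The middle line carries `M`: `L` is bounded by a constant -/

section Middle

variable {ξ δ : ℝ}

/-- **`|L(x)| ≤ A₂A₃·833/δ³` FOR ALL `x` WHEN THE MIDDLE LINE IS A DIFFERENCE KERNEL**: if `|(∂_μK₂∂^*_ν)(x,w)| ≤ A₂P₁^δ(x−w)` (the law of
the mixed second difference of `M = G − C^ξ`, gen 9's `abs_d2K_MxiL_le`: a once-differentiated-propagator law would be `P₃`, the
subtraction of `C^ξ` removes the singularity) and `|K₃(y′,w)| ≤ A₃P₁^δ(y′−w)`, then the two propagator-type lines form a uniformly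
summable pair (AM–GM, `tsum_profile_one_mul_le`). [cite: Balaban1983Higgs3, (3.38) p.444] -/
theorem abs_Lker_le_const_of_laws (hξ : 0 < ξ) (hξ1 : ξ ≤ 1) (hδ : 0 < δ) (hδ1 : δ ≤ 1) {μ ν : Fin 3}
    {K₂ K₃ : ZSite 3 → ZSite 3 → ℝ} {y' : ZSite 3} {A₂ A₃ : ℝ} (hA2 : 0 ≤ A₂) (hA3 : 0 ≤ A₃)
    (h2 : ∀ x w, |d2K ξ μ ν K₂ x w| ≤ A₂ * prof ξ δ 1 (x - w))
    (h3 : ∀ w, |K₃ y' w| ≤ A₃ * prof ξ δ 1 (y' - w)) (x : ZSite 3) :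
    Summable (fun w => ξ ^ 3 * (d2K ξ μ ν K₂ x w * K₃ y' w)) ∧ |Lker ξ μ ν K₂ K₃ y' x| ≤ A₂ * A₃ * (833 / δ ^ 3) := by
  obtain ⟨hsP, hbP⟩ := prof_pair_le hξ hξ1 hδ hδ1 x y'
  have hdom : ∀ w, |ξ ^ 3 * (d2K ξ μ ν K₂ x w * K₃ y' w)| ≤ A₂ * A₃ * (ξ ^ 3 * (prof ξ δ 1 (x - w) * prof ξ δ 1 (w - y'))) := by
    intro w
    rw [abs_mul, abs_of_pos (pow_pos hξ 3), abs_mul]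
    have hp1 := prof_nonneg hξ.le δ 1 (x - w)
    have hp2 := prof_nonneg hξ.le δ 1 (w - y')
    have hk := h3 w
    rw [prof_sub_comm ξ δ 1 y' w] at hk
    calc ξ ^ 3 * (|d2K ξ μ ν K₂ x w| * |K₃ y' w|) ≤ ξ ^ 3 * (A₂ * prof ξ δ 1 (x - w) * (A₃ * prof ξ δ 1 (w - y'))) :=
          mul_le_mul_of_nonneg_left (mul_le_mul (h2 x w) hk (abs_nonneg _) (by positivity)) (pow_pos hξ 3).le
      _ = A₂ * A₃ * (ξ ^ 3 * (prof ξ δ 1 (x - w) * prof ξ δ 1 (w - y'))) := by ring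
  have hs : Summable (fun w => ξ ^ 3 * (d2K ξ μ ν K₂ x w * K₃ y' w)) :=
    (Summable.of_nonneg_of_le (fun _ => abs_nonneg _) hdom (hsP.mul_left _)).of_abs
  refine ⟨hs, ?_⟩
  unfold Lker
  refine (abs_tsum_le_tsum_of_abs_le hs (hsP.mul_left _) hdom).trans ?_
  rw [tsum_mul_left]
  exact mul_le_mul_of_nonneg_left hbP (by positivity)

end Middle

/-! ## §4 The last line carries `M`: `L` is bounded by a constant (at the instance) -/

section Last

variable {ℓ k : ℕ} {a m2 : ℝ}

/-- kernel: the backward difference of `M(y′,·)` falls on the `C^ξ` inside `M = G(1 − m² − aP)C^ξ`: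
`ξ⁻¹(M(y′,w−e_ν) − M(y′,w)) = Σ'_z ξ³[G(1−m²−aP)](y′,z)·(∂^ξ_νC^ξ)(z − w)` (`hasSum_resolvent316` at `w − e_ν` and `w`).
[cite: Balaban1983Higgs3, (3.16) p.437] -/
theorem hasSum_pdiffAdjZ_MxiL (hℓ : 1 ≤ ℓ) (hk : 1 ≤ k) (ha : 0 < a) (hm : 0 ≤ m2) (ν : Fin 3) (y' w : ZSite 3) :
    HasSum (fun z => (xiOf ℓ k) ^ 3 * (smearG ℓ k a m2 y' z * pdiffZ (xiOf ℓ k)⁻¹ ν (Cxi 3 (xiOf ℓ k)) (z - w)))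
      (pdiffAdjZ (xiOf ℓ k)⁻¹ ν (MxiL ℓ k a m2 y') w) := by
  have h1 := hasSum_resolvent316 hℓ hk ha hm y' (w - unitVec ν)
  have h0 := hasSum_resolvent316 hℓ hk ha hm y' w
  have h := (h1.sub h0).mul_left ((xiOf ℓ k)⁻¹)
  have e : (fun z => (xiOf ℓ k) ^ 3 * (smearG ℓ k a m2 y' z * pdiffZ (xiOf ℓ k)⁻¹ ν (Cxi 3 (xiOf ℓ k)) (z - w))) =
      (fun z => (xiOf ℓ k)⁻¹ * ((xiOf ℓ k) ^ 3 * (smearG ℓ k a m2 y' z * Cxi 3 (xiOf ℓ k) (z - (w - unitVec ν))) -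
        (xiOf ℓ k) ^ 3 * (smearG ℓ k a m2 y' z * Cxi 3 (xiOf ℓ k) (z - w)))) := by
    funext z
    simp only [pdiffZ, show z - (w - unitVec ν) = z - w + unitVec ν by abel]
    ring
  rw [e]
  unfold pdiffAdjZ
  exact h

/-- **`|L(x)| ≤ 1400·A·C²·833/(δ/2)³` FOR ALL `x` WHEN THE LAST LINE IS THE DIFFERENCE KERNEL `M`** (`ξ = L^{−k}`; middle line the
convolution kernel `C^ξ`, or any translation-invariant kernel `K` with `|(∂_μK)(u)| ≤ A·P₂^δ(u)`): after the `y″`-summation by parts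
the backward difference sits on the `C^ξ` inside `M(y′,·) = Σ_z[G(1−m²−aP)](y′,z)C^ξ(z−·)` (`hasSum_pdiffAdjZ_MxiL`); the `y″`-sum
is done first (`(P₂ ⋆ P₂)(x − z) ≤ 1400P₁^{δ/2}`), then the `z`-sum against the middle factor's law `P₁(y′−z)` (AM–GM pair sum with
the two centres `y′`, `x`); the exchange is Tonelli (gen 9's `tsum_tsum_le_of_nonneg`).  Laws: `hS` (middle factor), `hC9`
(`∂^ξC^ξ`), `hK` (the middle line), `hMb` (`|M| ≤ K₀`, for summability). [cite: Balaban1983Higgs3, (3.38) p.444] -/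
theorem abs_Lker_conv_M_le_const (hℓ : 1 ≤ ℓ) (hk : 1 ≤ k) (ha : 0 < a) (hm : 0 ≤ m2) {δ C A K₀ : ℝ} (hδ : 0 < δ)
    (hδ1 : δ ≤ 1) (hC : 0 ≤ C) (hA : 0 ≤ A)
    (hS : ∀ y z : ZSite 3, |smearG ℓ k a m2 y z| ≤ C * prof (xiOf ℓ k) δ 1 (y - z))
    (hC9 : ∀ (μ : Fin 3) (u : ZSite 3), |pdiffZ (xiOf ℓ k)⁻¹ μ (Cxi 3 (xiOf ℓ k)) u| ≤ C * prof (xiOf ℓ k) δ 2 u)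
    (hMb : ∀ y w : ZSite 3, |MxiL ℓ k a m2 y w| ≤ K₀)
    {K : ZSite 3 → ℝ} (hK : ∀ (μ : Fin 3) (u : ZSite 3), |pdiffZ (xiOf ℓ k)⁻¹ μ K u| ≤ A * prof (xiOf ℓ k) δ 2 u)
    (μ ν : Fin 3) (y' x : ZSite 3) :
    |Lker (xiOf ℓ k) μ ν (fun p q => K (p - q)) (MxiL ℓ k a m2) y' x| ≤
      A * (C * C) * 1400 * (833 / (δ / 2) ^ 3) := by
  have hξ := xiOf_pos ℓ k
  have hξ1 := xiOf_le_one ℓ k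
  set ξ : ℝ := xiOf ℓ k with hξdef
  have hδ' : 0 < δ / 2 := by linarith
  have hδ'1 : δ / 2 ≤ 1 := by linarith
  -- `∂_μ` of the middle (translation-invariant) line
  have hdK1 : ∀ p q : ZSite 3, |dK1 ξ μ (fun p q => K (p - q)) p q| ≤ A * prof ξ δ 2 (p - q) := by
    intro p q; rw [dK1_conv]; exact hK μ (p - q)
  -- the two summability hypotheses of `Lker_eq_sbp`
  have hs1 : Summable fun w => dK1 ξ μ (fun p q => K (p - q)) x (w + unitVec ν) * MxiL ℓ k a m2 y' w := by
    refine summable_of_le_prof_left hξ hξ1 hδ hδ1 (le_refl 2) (x - unitVec ν) (c := A * K₀ * (ξ ^ 3)⁻¹) fun w => ?_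
    have e : x - (w + unitVec ν) = x - unitVec ν - w := by abel
    have h1 := hdK1 x (w + unitVec ν); rw [e] at h1
    have hp := prof_nonneg hξ.le δ 2 (x - unitVec ν - w)
    rw [abs_mul]
    calc |dK1 ξ μ (fun p q => K (p - q)) x (w + unitVec ν)| * |MxiL ℓ k a m2 y' w|
        ≤ A * prof ξ δ 2 (x - unitVec ν - w) * K₀ := mul_le_mul h1 (hMb y' w) (abs_nonneg _) (by positivity)
      _ = A * K₀ * (ξ ^ 3)⁻¹ * (ξ ^ 3 * prof ξ δ 2 (x - unitVec ν - w)) := by field_simp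
  have hs2 : Summable fun w => dK1 ξ μ (fun p q => K (p - q)) x w * MxiL ℓ k a m2 y' w := by
    refine summable_of_le_prof_left hξ hξ1 hδ hδ1 (le_refl 2) x (c := A * K₀ * (ξ ^ 3)⁻¹) fun w => ?_
    have hp := prof_nonneg hξ.le δ 2 (x - w)
    rw [abs_mul]
    calc |dK1 ξ μ (fun p q => K (p - q)) x w| * |MxiL ℓ k a m2 y' w| ≤ A * prof ξ δ 2 (x - w) * K₀ :=
          mul_le_mul (hdK1 x w) (hMb y' w) (abs_nonneg _) (by positivity)
      _ = A * K₀ * (ξ ^ 3)⁻¹ * (ξ ^ 3 * prof ξ δ 2 (x - w)) := by field_simp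
  rw [Lker_eq_sbp x hs1 hs2]
  -- the Tonelli majorant `F z w` and its `w`-sums `H z`
  set F : ZSite 3 → ZSite 3 → ℝ := fun z w =>
    (A * (C * C)) * ((ξ ^ 3 * prof ξ δ 1 (y' - z)) * (ξ ^ 3 * (prof ξ δ 2 (x - w) * prof ξ δ 2 (w - z)))) with hF
  have hF0 : ∀ z w, 0 ≤ F z w := fun z w => by
    have := prof_nonneg hξ.le δ 1 (y' - z); have := prof_nonneg hξ.le δ 2 (x - w)
    have := prof_nonneg hξ.le δ 2 (w - z); positivity
  set H : ZSite 3 → ℝ := fun z =>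
    (A * (C * C) * 1400) * (ξ ^ 3 * (prof ξ (δ / 2) 1 (y' - z) * prof ξ (δ / 2) 1 (z - x))) with hH
  have hFz : ∀ z, Summable (F z) := fun z =>
    ((prof_conv22_le hξ hδ x z).1.mul_left (ξ ^ 3 * prof ξ δ 1 (y' - z))).mul_left _
  have hFH : ∀ z, ∑' w, F z w ≤ H z := by
    intro z
    obtain ⟨-, hle⟩ := prof_conv22_le hξ hδ x z
    have hp := prof_nonneg hξ.le δ 1 (y' - z)
    have hw : prof ξ δ 1 (y' - z) ≤ prof ξ (δ / 2) 1 (y' - z) := prof_mono_rate hξ.le (by linarith) 1 _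
    simp only [hF, hH]
    rw [tsum_mul_left, tsum_mul_left]
    rw [prof_sub_comm ξ (δ / 2) 1 z x]
    have hS0 : 0 ≤ ∑' w, ξ ^ 3 * (prof ξ δ 2 (x - w) * prof ξ δ 2 (w - z)) :=
      tsum_nonneg fun w => by
        have := prof_nonneg hξ.le δ 2 (x - w); have := prof_nonneg hξ.le δ 2 (w - z); positivity
    have hp' := prof_nonneg hξ.le (δ / 2) 1 (y' - z)
    calc A * (C * C) * (ξ ^ 3 * prof ξ δ 1 (y' - z) * ∑' w, ξ ^ 3 * (prof ξ δ 2 (x - w) * prof ξ δ 2 (w - z)))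
        ≤ A * (C * C) * (ξ ^ 3 * prof ξ (δ / 2) 1 (y' - z) * (1400 * prof ξ (δ / 2) 1 (x - z))) := by
          refine mul_le_mul_of_nonneg_left ?_ (by positivity)
          exact mul_le_mul (mul_le_mul_of_nonneg_left hw (pow_pos hξ 3).le) hle hS0 (by positivity)
    _ = A * (C * C) * 1400 * (ξ ^ 3 * (prof ξ (δ / 2) 1 (y' - z) * prof ξ (δ / 2) 1 (x - z))) := by ring
  obtain ⟨hHs, hHle⟩ := prof_pair_le hξ hξ1 hδ' hδ'1 y' x
  have hHsum : Summable H := hHs.mul_left _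
  obtain ⟨hFw, hsw, hle⟩ := tsum_tsum_le_of_nonneg hF0 hFz hFH hHsum
  -- the integrand after summation by parts, dominated by `Σ'_z F z w`
  have hdom : ∀ w, |ξ ^ 3 * (dK1 ξ μ (fun p q => K (p - q)) x w * pdiffAdjZ ξ⁻¹ ν (MxiL ℓ k a m2 y') w)| ≤ ∑' z, F z w := by
    intro w
    have hsum := hasSum_pdiffAdjZ_MxiL hℓ hk ha hm ν y' w
    rw [← hξdef] at hsum
    rw [← hsum.tsum_eq, abs_mul, abs_of_pos (pow_pos hξ 3), abs_mul]
    -- `|Σ_z ξ³S(y′,z)(∂_νC)(z−w)| ≤ Σ_z ξ³·C P₁(y′−z)·C P₂(z−w)`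
    have hint : ∀ z, |ξ ^ 3 * (smearG ℓ k a m2 y' z * pdiffZ ξ⁻¹ ν (Cxi 3 ξ) (z - w))| ≤
        ξ ^ 3 * (C * prof ξ δ 1 (y' - z) * (C * prof ξ δ 2 (z - w))) := by
      intro z
      rw [abs_mul, abs_of_pos (pow_pos hξ 3), abs_mul]
      have hp := prof_nonneg hξ.le δ 1 (y' - z)
      exact mul_le_mul_of_nonneg_left (mul_le_mul (hS y' z) (hC9 ν (z - w)) (abs_nonneg _) (by positivity))
        (pow_pos hξ 3).le
    have hmaj : Summable fun z => ξ ^ 3 * (C * prof ξ δ 1 (y' - z) * (C * prof ξ δ 2 (z - w))) := by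
      have hb : ∀ z, ξ ^ 3 * (C * prof ξ δ 1 (y' - z) * (C * prof ξ δ 2 (z - w))) ≤
          C * C * ξ⁻¹ * (ξ ^ 3 * prof ξ δ 2 (z - w)) := by
        intro z
        have h1 : prof ξ δ 1 (y' - z) ≤ ξ⁻¹ := by
          have : prof ξ δ 1 (y' - z) ≤ (ξ ^ 1)⁻¹ := profile_le_inv_pow hξ hδ.le 1 (y' - z)
          rwa [pow_one] at this
        have hp2 := prof_nonneg hξ.le δ 2 (z - w)
        calc ξ ^ 3 * (C * prof ξ δ 1 (y' - z) * (C * prof ξ δ 2 (z - w)))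
            = C * C * prof ξ δ 1 (y' - z) * (ξ ^ 3 * prof ξ δ 2 (z - w)) := by ring
          _ ≤ C * C * ξ⁻¹ * (ξ ^ 3 * prof ξ δ 2 (z - w)) := by gcongr
      have h0 : ∀ z, 0 ≤ ξ ^ 3 * (C * prof ξ δ 1 (y' - z) * (C * prof ξ δ 2 (z - w))) := fun z => by
        have := prof_nonneg hξ.le δ 1 (y' - z); have := prof_nonneg hξ.le δ 2 (z - w); positivity
      exact Summable.of_nonneg_of_le h0 hb ((prof_summable_right hξ hξ1 hδ hδ1 (le_refl 2) w).1.mul_left _)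
    have hI := abs_tsum_le_tsum_of_abs_le hsum.summable hmaj hint
    have hp := prof_nonneg hξ.le δ 2 (x - w)
    calc ξ ^ 3 * (|dK1 ξ μ (fun p q => K (p - q)) x w| *
            |∑' z, ξ ^ 3 * (smearG ℓ k a m2 y' z * pdiffZ ξ⁻¹ ν (Cxi 3 ξ) (z - w))|)
        ≤ ξ ^ 3 * (A * prof ξ δ 2 (x - w) * ∑' z, ξ ^ 3 * (C * prof ξ δ 1 (y' - z) * (C * prof ξ δ 2 (z - w)))) :=
          mul_le_mul_of_nonneg_left (mul_le_mul (hdK1 x w) hI (abs_nonneg _) (by positivity)) (pow_pos hξ 3).le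
      _ = ∑' z, F z w := by
          rw [← tsum_mul_left, ← tsum_mul_left]
          refine tsum_congr fun z => ?_
          simp only [hF]
          rw [prof_sub_comm ξ δ 2 w z]
          ring
  have hs : Summable fun w => ξ ^ 3 * (dK1 ξ μ (fun p q => K (p - q)) x w * pdiffAdjZ ξ⁻¹ ν (MxiL ℓ k a m2 y') w) :=
    (Summable.of_nonneg_of_le (fun _ => abs_nonneg _) hdom hsw).of_abs
  refine (abs_tsum_le_tsum_of_abs_le hs hsw hdom).trans (hle.trans ?_)
  simp only [hH]
  rw [tsum_mul_left]
  exact mul_le_mul_of_nonneg_left hHle (by positivity)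

end Last

end

end Literature.MathematicalPhysics.QuantumFieldTheory.Balaban1983to89.B3Eq338LkerBounds
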